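import Literature.MathematicalPhysics.QuantumFieldTheory.BalabanImbrieJaffe1984to88.BIJ88LocatedActivityBound309
import Literature.MathematicalPhysics.QuantumFieldTheory.BalabanImbrieJaffe1984to88.BIJ88WalkTermBound309
import Literature.MathematicalPhysics.QuantumFieldTheory.BalabanImbrieJaffe1984to88.BIJ88Ineq5144Located

/-!
# `BalabanImbrieJaffe1984to88.BIJ88Ineq5144BoundedSize309` — T. Bałaban, J. Imbrie, A. Jaffe, *Effective action and cluster properties of the
abelian Higgs model*, Commun. Math. Phys. **114** (1988) 257–315 [BalabanImbrieJaffe1988], Sect. 5.14, (5.14.4) p. 309 [PDF 53] L12–15: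
*"Let us drop the prime, and prove that (5.14.4) |g₃(H_β, X_β)| ≦ (e^β(L^kε/ε₀)^{1/4−α})^{[|H_β| + β′|X_β∖H_β|]}.  We use X_β∖H_β to denote the set
of cubes with no (d/dt)_{γ_j} factors, j ∈ H_β.  The proof of this estimate is similar to the one for g₂"* (below `θ := e^β(L^kε/ε₀)^{1/4−α}`), with
Sect. 5.13 p. 307 [PDF 51] L2–27 (the proof for `g₂`: small factors at the ends of the covariance chains, Gaussian shells `e^{−cp(e_k)²}` for the
derivatives hitting χ-factors, *"combinatoric factors exp((e^β(L^kε/ε₀)^{1/4−α})^{β′}|X_α|), β′ > 0. Such factors are easily beaten by the small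
factors described above for nonexceptional cubes"*) — **THE LOCATED (5.14.4) ON THE LINEAGE'S MODEL IN THE BOUNDED-SIZE REGIME
`2 ≤ |X″| ≤ N₀`**: for the prime-dropped
located activity `actIn … H X″` of `BIJ88W6PrimeVsupp` (every decoration pattern: χ-slots and `V`-slots in every cube, coupled covariance
`Δ_{1_Λ}`, `t ∈ (0,1]`), `|g₃(H, X″)| ≤ θ^{|H| + β′|X″∖X_H|}` — obtained from the MASTER BOUND `BIJ88LocatedActivityBound309.abs_actIn_le_master`
(walk expansion §5.13 of the lineage: E4b `BIJ88ActivityWalkBound309` ∘ E4c `BIJ88TermHitShellBound309` ∘ E4d `BIJ88TrainTermBound307`) by the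
per-term bookkeeping `BIJ88WalkTermBound309.term_le` and the crude counts `BIJ88WalkTermCounting309`, under BOUNDED LETTERS and an explicit
`N₀`-dependent COUNTING CLAUSE `hcnt` (print's *"combinatoric factors … easily beaten"*, here as a displayed hypothesis because the letters are
carried, not evaluated):
* `abs_actIn_le_rpow_of_card_le` — located `H` (every label's cube in `X″`): `|actIn … H X″| ≤ θ^{|H| + β′|X″∖X_H|}`;
* `abs_locAct_actIn_le_rpow_of_card_le` — the same for `BIJ88Ineq5144Located.locAct (cubeIn cube X ∘ γ′) (actIn …) H X″` (the shape of the leaf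
  `h5144three` of `BIJ88Eq5145HeadThreeCubeChi.eq5145_zG_mod_W6v_of_ineq5144_three_le_struct_chi`, for `|X″| ≤ N₀`).

statement-level skeleton of published theorems with citation tags; proofs where landed; nothing here is a claim about the Yang–Mills mass gap

PDF held: `paper:balaban1988-cmp114-bij-abelian-higgs-effective-action` (journal page = PDF page + 256); pages re-read this session as text:
PDF 51 (p. 307) L2–23, PDF 53 (p. 309) L10–28.

CITATION HEADER (lean-in-tree rule).  Part of the lit-balaban TYPED SKELETON (HOME `run/shared/lean/pub/lit-balaban/`), Phase 2, seat p36
(gen 22; re-filed gen 23, unit `lit-balaban-p36`); rows **C2.Eq5.14.3-5.14.4** (member: §f assembly — bounded-size instance of the located (5.14.4)) and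
C2.Eq5.13.3-5.13.4 (member) of `HOME/lit-balaban-r16/ROWS-C2-part2.md` (owner r16, referee ref-5).  Theorem-only; no definitions, no `Prop` facts;
axioms standard.
THE CLASS (data).  The §5.13/§5.14 model of the lineage (`BIJ88W6PrimeVsupp.actIn`: sites `α`, cubes `I`, block map `blk`, precision `Δ ≻ 0` with
`m·1 ≤ Δ ≤ C₀·1`, source `ℱ` with the sitewise letter `|ℱ_q| ≤ F_q ≤ F₀`, `|sites of X″|·F₀ ≤ 1` and `‖ℱ↾X″‖ ≤ F`; χ-slots `b ∈ B` (linear fields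
`Φ_b`, `c_b ≠ 0`, profile `χ`, `p`, `e_k`, `0 < t ≤ 1`, `t e_k < 1`) and `V`-slots `Y ∈ Ys` (`V_Y ∈ C_b^∞` — typing gap #1 as a hypothesis) placed
in cubes by `cube`, EVERY decoration pattern; the region `X`, labels `γ′ : S → slots`, `H ⊆ S`; the polymer `X″` with `2 ≤ |X″| ≤ N₀` and a site;
coupled covariance `Δ_{1_{Λc}}` interpolated in `s ∈ [0,1]^I` (integrated by the walk expansion); NO DECAY LETTER.
THE LETTERS (data; `N₀`-dependence explicit).  `A_τ(m,n) ≥ 0`, `0 ≤ w_τ ≤ 1` (slot costs: χ-slots `t^{m}A_b(m,n) ≤ Aχ` for `m ≤ M`, `n ≤ 2N₀`,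
`A_b(0,0) = 1`, with the located-derivative/shell letter `hχ` of `BIJ88TermHitShellBound309` §3; `V`-slots `A_Y(m,n) ≤ AV·θV^{m+n}` with `hY`);
walk-kernel certificates `|(C_s𝔫_s(c))(x,y)| ≤ κ_c(x,y) ≤ K₁` UNIFORM in `s`; frame letter `Λ` of the located χ-slots; shells
`2e^{−a_b(a_b−2ΛF/m)/(2Λ²/m)} ≤ (t e_k)^M·θS` per located χ-slot; smallness `e_k ≤ θ ≤ 1`, `θV ≤ θ`, `θS ≤ ε θ^{β′N₀}`, `θV ≤ ε θ^{β′N₀}` (clause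
(ii) of the earlier instances = the `V`-letter: here `hAV′` + `hVε`); sizes `|sites of X″| ≤ n_X`, `|located slots| ≤ G`, `|H| ≤ M`; and the COUNTING
CLAUSE `hcnt : 2^{2^{N₀}}·2^{2^{N₀}}·(n_X + n_X²)^{N₀}·G^{2N₀}·K₁^{N₀}·Aχ^{G}·AV^{G}·ε ≤ 1`.
θ-ACCOUNTING (condition (c); print (5.14.4) p. 309: `θ^{[|H_β| + β′|X_β∖H_β|]}`, `θ = e^β(L^kε/ε₀)^{1/4−α}`).  `θ^{|H|}`: the `t`-derivatives are located slot by slot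
(`Σ_τ m_τ = |H|`, `card_eq_sum_card_fiberwise`); a χ-slot hit by `m ≥ 1` of them is a HIT slot, its Gaussian shell `(t e_k)^M θS` turns the letter's
`t^{−m}` into `e_k^{m} ≤ θ^{m}` (print p. 307 L4–5: *"an even smaller factor if the derivative is with respect to t, due to the factor δ_t
multiplying 𝔄 in (5.8.3)"* with L7 *"e^{−r(e_k)} associated with a derivative of χ′"*); a `V`-slot pays `θV^{m} ≤ θ^{m}` (its letter).  `θ^{β′·|X″∖X_H|}`:
EVERY term of the walk expansion of a polymer with `≥ 2` cubes has `≥ 1` train (`toList_length_pos`), whose inner leg lands on a located slot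
(`trainLegs_nonempty`, the assignment ranges over located slots) and pays `ε θ^{β′N₀} ≤ ε θ^{β′|X″∖X_H|}` — through that slot's shell `θS` if a
χ-slot (print's ONE `e^{−r(e_k)}` of p. 307 L7), through `θV` if a `V`-slot (clause (ii)); `ε` absorbs the counts (`hcnt`).  So the `β′`-part is
bought by ONE small factor spread over `≤ N₀` cubes (`β′ ≲ 1/N₀` in print's currency `θ = e^{−r(e_k)}`): print instead pays `e^{−cr(e_k)}` PER
nonexceptional cube by site-level walk decay (p. 307 L14–16) — at `|X″| ≤ N₀` print's price per cube is a fixed power of `θ`, ours is the same ONE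
shell/letter divided over `N₀` cubes: NOT cheaper in kind (a printed small factor), WEAKER in rate (declared; referee check (3)).  VACUUM (`H = ∅`):
no separate vacuum clause — the same leg mechanism gives `θ^{β′|X″|}` (the earlier instances' `hvac` is subsumed: `|X″| ≥ 2` forces a train).
DIVERGENCES OF METHOD (condition (e)).  Gaussian shells by completing the square/Chernoff (`BIJ88GaussShellBound309`), not [3] §14; the observable
product expanded into slot-derivative assignments BEFORE integrating (E4a′, per-hit shells); the sums over vertex structures, groupings, end data and
assignments bounded by CRUDE COUNTS (`BIJ88WalkTermCounting309`), not by the [9] (Glimm–Jaffe–Spencer) combinatorics with walk decay; no conditioning.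
HONEST SCOPE.  (1) BOUNDED SIZE ONLY: `hcnt`, `hSε`, `hVε` are `N₀`-dependent, so this is NOT print's volume-uniform (5.14.4): for large `|X″|`
print's bound comes from per-cube walk decay across nonexceptional cubes and *"the sum over walks and partitions, and the factorials, as in [9]"*, a
site-level argument the lineage's cube-indexed model does not carry (HOME `GAPS.md` G-C2-p36-10, ADDENDUM 4; owner design ruling v2.368).  (2) Every
size is a LETTER (hypothesis), none is evaluated on the model here; the χ-letter is dischargeable by `BIJ88ChiSlotDsetBound309`, the `V`-letter is
r16's typing gap #1 in all-orders form, the kernel certificates are NOT derived from `Δ`-letters here.  (3) Linear χ-slot fields; a site in `X″`.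
(4) No non-vacuity certificate in this file.  NOT summit progress; NOT continuum; NOT Clay.
-/

namespace Literature.MathematicalPhysics.QuantumFieldTheory.BalabanImbrieJaffe1984to88.BIJ88Ineq5144BoundedSize309

open Finset Matrix
open scoped BigOperators
open Literature.Probability.LatticeModels (setPartitions)
open BIJ88DirichletForms305 (interpForm)
open BIJ88PairingAllOrders5133 (smallParts)
open BIJ88WickSourceSmooth305 (dset)
open BIJ88SmoothFactors5133 (CbInf)
open BIJ88TrainPieces306 (wker)
open BIJ88TrainsDsetExpansion306 (trainLegs trainSite)
open BIJ88TruncationConnected5133 (bmat)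
open BIJ88PolymerRep5134 (corner)
open BIJ88PolymerRep5134Gauss (prec src ext)
open BIJ88Sect5Statements (CutoffProfile)
open BIJ88SlotMomentsGauss308 (uD)
open BIJ88Eq5145CornerModel (slotB slotY)
open BIJ88Eq5145CornerUrsell (cubeIn)
open BIJ88W6PrimeVsupp (actIn)
open BIJ88Ineq5144Located (locAct locAct_of_loc locAct_of_not_loc)
open BIJ88LocatedActivityBound309 (abs_actIn_le_master)
open BIJ88WalkTermCounting309 (length_toList_le card_asg_le card_endData card_setPartitions_smallParts_le card_smallParts_le)
open BIJ88WalkTermBound309 (term_le)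

variable {α I : Type} [Fintype α] [DecidableEq α] [Fintype I] [DecidableEq I] (blk : α → I) (Δ : Matrix α α ℝ) (ℱ : α → ℝ)
variable (χ : CutoffProfile) {ι υ : Type} [DecidableEq ι] [DecidableEq υ] (p : ℝ) {ek t : ℝ} (B : Finset ι)
  {Φ : ι → (α → ℝ) → ℝ} {c : ι → ℝ} (Ys : Finset υ) {V : υ → (α → ℝ) → ℝ} (cube : ↥B ⊕ ↥Ys → I)
variable (adj : I → I → Prop) [DecidableRel adj] (Λc : Finset I)

/-- **THE LOCATED (5.14.4) IN THE BOUNDED-SIZE REGIME, LOCATED `H`** (p. 309 L19–28 with p. 307 L2–23; see the module docstring for the regime,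
the letters and the counting clause): for `2 ≤ |X″| ≤ N₀` and every label of `H` located in `X″`,
`|actIn … H X″| ≤ θ^{|H| + β′·|X″ ∖ X_H|}`, `X_H = (cubeIn cube X ∘ γ′)'' H`. [cite: BalabanImbrieJaffe1988, (5.14.4) p.309 L19–28; §5.13 p.307 L2–23] -/
theorem abs_actIn_le_rpow_of_card_le (hΔ : Δ.PosDef) {m C₀ : ℝ} (hm : 0 < m)
    (hΔm : ∀ φ : α → ℝ, m * (φ ⬝ᵥ φ) ≤ φ ⬝ᵥ (Δ *ᵥ φ)) (hCΔ : ∀ v, v ⬝ᵥ (Δ *ᵥ v) ≤ C₀ * (v ⬝ᵥ v))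
    (hek : 0 < ek) (ht : 0 < t) (h1 : t * ek < 1) (hΦ : ∀ b ∈ B, IsLinearMap ℝ (Φ b)) (hc : ∀ b ∈ B, c b ≠ 0)
    (hV : ∀ Y ∈ Ys, CbInf (V Y))
    (X : Finset I) {S : Type*} [DecidableEq S] (γ' : S → ↥(slotB B Ys cube X) ⊕ ↥(slotY B Ys cube X)) (H : Finset S)
    {X'' : Finset I} (h2 : 2 ≤ X''.card) (hXs : ∃ x, blk x ∈ X'') (τ₀ : ↥(slotB B Ys cube X) ⊕ ↥(slotY B Ys cube X))
    {Λ : ℝ} (hΛ : 0 < Λ)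
    (hframe : ∀ (θ : ↥(univ.filter fun b : ↥(slotB B Ys cube X) => cubeIn cube X (Sum.inl b) ∈ X'') → ℝ) (φ : α → ℝ),
      |∑ b, θ b * Φ b.1.1 φ| ≤ Λ * Real.sqrt (∑ b, θ b ^ 2) * Real.sqrt (φ ⬝ᵥ φ))
    {F : ℝ} (hF0 : 0 ≤ F) (hF : src blk ℱ X'' ⬝ᵥ src blk ℱ X'' ≤ F ^ 2) {a a' : ↥(slotB B Ys cube X) → ℝ} (ha : ∀ b, 0 ≤ a b)
    {A : ↥(slotB B Ys cube X) ⊕ ↥(slotY B Ys cube X) → ℕ → ℕ → ℝ} (hA : ∀ τ m n, 0 ≤ A τ m n)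
    (hA1 : ∀ b : ↥(slotB B Ys cube X), 1 ≤ A (Sum.inl b) 0 0)
    {w : ↥(slotB B Ys cube X) ⊕ ↥(slotY B Ys cube X) → BIJ88PolymerRep5134Gauss.Site blk X'' → ℝ} (hw : ∀ τ x, 0 ≤ w τ x)
    (hχ : ∀ (κ : Type) [LinearOrder κ] (q : κ → BIJ88PolymerRep5134Gauss.Site blk X'') (b : ↥(slotB B Ys cube X)) (m : ℕ)
      (D' : Finset κ) (φ : BIJ88PolymerRep5134Gauss.Site blk X'' → ℝ), (m ≠ 0 ∨ D'.card ≠ 0) →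
      |dset (fun j => Pi.single (q j) (1 : ℝ)) D'
        (fun ψ => uD χ p ek (slotB B Ys cube X) (fun b : ↥B => Φ b) (fun b : ↥B => c b) (slotY B Ys cube X) (fun Y : ↥Ys => V Y) t
          (Sum.inl b) m (ext blk X'' ψ)) φ| ≤
        A (Sum.inl b) m D'.card * (∏ j ∈ D', w (Sum.inl b) (q j)) *
          Set.indicator (Set.Icc (a b) (a' b)) (fun _ => (1 : ℝ)) |Φ b.1 (ext blk X'' φ)|)
    (hY : ∀ (κ : Type) [LinearOrder κ] (q : κ → BIJ88PolymerRep5134Gauss.Site blk X'') (Y : ↥(slotY B Ys cube X)) (m : ℕ)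
      (D' : Finset κ) (φ : BIJ88PolymerRep5134Gauss.Site blk X'' → ℝ),
      |dset (fun j => Pi.single (q j) (1 : ℝ)) D'
        (fun ψ => uD χ p ek (slotB B Ys cube X) (fun b : ↥B => Φ b) (fun b : ↥B => c b) (slotY B Ys cube X) (fun Y : ↥Ys => V Y) t
          (Sum.inr Y) m (ext blk X'' ψ)) φ| ≤
        A (Sum.inr Y) m D'.card * ∏ j ∈ D', w (Sum.inr Y) (q j))
    {κc : Finset (Finset I) → BIJ88PolymerRep5134Gauss.Site blk X'' → BIJ88PolymerRep5134Gauss.Site blk X'' → ℝ}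
    (hκ : ∀ s : I → ℝ, (∀ i, 0 ≤ s i ∧ s i ≤ 1) → ∀ (cg : Finset (Finset I)) (x y : BIJ88PolymerRep5134Gauss.Site blk X''),
      |((prec blk (interpForm blk Δ (corner ℝ Λc)) X'' s)⁻¹ *
          wker (prec blk (interpForm blk Δ (corner ℝ Λc)) X'' s)⁻¹
            (fun b => bmat (fun x : BIJ88PolymerRep5134Gauss.Site blk X'' => blk x.1)
                ((interpForm blk Δ (corner ℝ Λc)).submatrix Subtype.val Subtype.val) s b
              + (bmat (fun x : BIJ88PolymerRep5134Gauss.Site blk X'' => blk x.1)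
                ((interpForm blk Δ (corner ℝ Λc)).submatrix Subtype.val Subtype.val) s b)ᵀ) cg) x y| ≤ κc cg x y)
    {Fq : BIJ88PolymerRep5134Gauss.Site blk X'' → ℝ} (hFq : ∀ q : BIJ88PolymerRep5134Gauss.Site blk X'', |ℱ q.1| ≤ Fq q)
    {N₀ M nX GX : ℕ} (hN : X''.card ≤ N₀) (hHM : H.card ≤ M)
    (hnX : Fintype.card (BIJ88PolymerRep5134Gauss.Site blk X'') ≤ nX)
    (hGX : (univ.filter fun τ : ↥(slotB B Ys cube X) ⊕ ↥(slotY B Ys cube X) => cubeIn cube X τ ∈ X'').card ≤ GX) (hGX1 : 1 ≤ GX)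
    (ht1 : t ≤ 1) (hw1 : ∀ τ x, w τ x ≤ 1) {K₁ F₀ : ℝ} (hK1 : 1 ≤ K₁) (hκ1 : ∀ cg x y, κc cg x y ≤ K₁) (hFq1 : ∀ y, Fq y ≤ F₀)
    (hvol : (Fintype.card (BIJ88PolymerRep5134Gauss.Site blk X'') : ℝ) * F₀ ≤ 1)
    {θ θS θV Aχ AV ε β' : ℝ} (hekθ : ek ≤ θ) (hθ1 : θ ≤ 1) (hθS0 : 0 ≤ θS) (hθS1 : θS ≤ 1) (hθV0 : 0 ≤ θV) (hθVθ : θV ≤ θ)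
    (hAχ : 1 ≤ Aχ) (hAV : 1 ≤ AV) (hε : 0 ≤ ε) (hβ : 0 ≤ β')
    (hSε : θS ≤ ε * θ ^ (β' * (N₀ : ℝ))) (hVε : θV ≤ ε * θ ^ (β' * (N₀ : ℝ)))
    (hAχ' : ∀ b md nd, md ≤ M → nd ≤ 2 * N₀ → t ^ md * A (Sum.inl b) md nd ≤ Aχ) (hA10 : ∀ b, A (Sum.inl b) 0 0 ≤ 1)
    (hAV' : ∀ Y md nd, md ≤ M → nd ≤ 2 * N₀ → A (Sum.inr Y) md nd ≤ AV * θV ^ (md + nd))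
    (hS : ∀ b : ↥(slotB B Ys cube X), cubeIn cube X (Sum.inl b) ∈ X'' →
      2 * Real.exp (-(a b * (a b - 2 * (Λ * F / m)) / (2 * (Λ ^ 2 / m)))) ≤ (t * ek) ^ M * θS)
    (hcnt : (2 : ℝ) ^ 2 ^ N₀ * (2 : ℝ) ^ 2 ^ N₀ * ((nX : ℝ) + (nX : ℝ) ^ 2) ^ N₀ * (GX : ℝ) ^ (2 * N₀) * K₁ ^ N₀ * Aχ ^ GX *
      AV ^ GX * ε ≤ 1)
    (hHloc : ∀ j ∈ H, cubeIn cube X (γ' j) ∈ X'') :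
    |actIn blk Δ ℱ adj χ p ek B Φ c Ys V cube Λc X t γ' H X''| ≤
      θ ^ ((H.card : ℝ) + β' * ((X'' \ H.image (cubeIn cube X ∘ γ')).card : ℝ)) := by
  have hθ0 : 0 < θ := hek.trans_le hekθ
  have hK0 : 0 ≤ K₁ := zero_le_one.trans hK1
  have hκ0 : ∀ cg x y, 0 ≤ κc cg x y := fun cg x y =>
    (abs_nonneg _).trans (hκ (fun _ => 0) (fun _ => ⟨le_rfl, zero_le_one⟩) cg x y)
  have hFq0 : ∀ y, 0 ≤ Fq y := fun y => (abs_nonneg _).trans (hFq y)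
  have hXne : X''.Nonempty := card_pos.1 (lt_of_lt_of_le two_pos h2)
  obtain ⟨x₀, hx₀⟩ := hXs
  have hns : 1 ≤ Fintype.card (BIJ88PolymerRep5134Gauss.Site blk X'') := Fintype.card_pos_iff.2 ⟨⟨x₀, hx₀⟩⟩
  have hnX1 : 1 ≤ nX := hns.trans hnX
  have hB0 : 0 ≤ K₁ ^ N₀ * (Aχ ^ GX * AV ^ GX * θ ^ H.card * (ε * θ ^ (β' * (N₀ : ℝ)))) :=
    mul_nonneg (pow_nonneg hK0 _) (mul_nonneg (mul_nonneg (mul_nonneg (pow_nonneg (zero_le_one.trans hAχ) _)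
      (pow_nonneg (zero_le_one.trans hAV) _)) (pow_nonneg hθ0.le _)) (mul_nonneg hε (Real.rpow_nonneg hθ0.le _)))
  refine (abs_actIn_le_master blk Δ ℱ χ p B Ys cube adj Λc hΔ hm hΔm hCΔ hek ht h1 hΦ hc hV X γ' H h2 ⟨x₀, hx₀⟩ τ₀ hΛ hframe hF0 hF
    ha hA hA1 hw hχ hY hκ hFq).trans ?_
  refine (sum_le_sum fun σ hσ => sum_le_sum fun P hP => sum_le_sum fun E _ => sum_le_sum fun g hg =>
    term_le (cubeIn cube X) X'' γ' H hHloc hHM hN hXne hGX hσ hP E τ₀ hg hK1 hκ0 hκ1 hFq0 hFq1 hvol hA hw hw1 ht ht1 hek.le hekθ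
      hθ1 hθS0 hθS1 hθV0 hθVθ hAχ hAV hε hSε hVε hAχ' hA10 hAV' hS).trans ?_
  -- the counts: assignments, end data, groupings, vertex structures
  have hstep : ∀ σ ∈ smallParts X'', ∀ P ∈ setPartitions σ,
      ∑ E : Fin P.toList.length → BIJ88PolymerRep5134Gauss.Site blk X'' ⊕
          (BIJ88PolymerRep5134Gauss.Site blk X'' × BIJ88PolymerRep5134Gauss.Site blk X''),
        ∑ g ∈ Fintype.piFinset (fun j => if j ∈ trainLegs E then univ.filter (fun τ => cubeIn cube X τ ∈ X'') else {τ₀}),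
          K₁ ^ N₀ * (Aχ ^ GX * AV ^ GX * θ ^ H.card * (ε * θ ^ (β' * (N₀ : ℝ)))) ≤
      ((nX : ℝ) + (nX : ℝ) ^ 2) ^ N₀ * ((GX : ℝ) ^ (2 * N₀) *
        (K₁ ^ N₀ * (Aχ ^ GX * AV ^ GX * θ ^ H.card * (ε * θ ^ (β' * (N₀ : ℝ)))))) := by
    intro σ hσ P hP
    have hn : P.toList.length ≤ N₀ := (length_toList_le hσ hP).trans hN
    have hg : ∀ E : Fin P.toList.length → BIJ88PolymerRep5134Gauss.Site blk X'' ⊕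
          (BIJ88PolymerRep5134Gauss.Site blk X'' × BIJ88PolymerRep5134Gauss.Site blk X''),
        ∑ g ∈ Fintype.piFinset (fun j => if j ∈ trainLegs E then univ.filter (fun τ => cubeIn cube X τ ∈ X'') else {τ₀}),
          K₁ ^ N₀ * (Aχ ^ GX * AV ^ GX * θ ^ H.card * (ε * θ ^ (β' * (N₀ : ℝ)))) ≤
        (GX : ℝ) ^ (2 * N₀) * (K₁ ^ N₀ * (Aχ ^ GX * AV ^ GX * θ ^ H.card * (ε * θ ^ (β' * (N₀ : ℝ))))) := by
      intro E
      rw [sum_const, nsmul_eq_mul]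
      refine mul_le_mul_of_nonneg_right ?_ hB0
      have h := (card_asg_le (univ.filter fun τ : ↥(slotB B Ys cube X) ⊕ ↥(slotY B Ys cube X) => cubeIn cube X τ ∈ X'') τ₀
        (trainLegs E) hGX hGX1).trans (Nat.pow_le_pow_right hGX1
          (show Fintype.card (Fin P.toList.length ×ₗ Fin 2) ≤ 2 * N₀ by
            rw [Fintype.card_lex, Fintype.card_prod, Fintype.card_fin, Fintype.card_fin]; omega))
      exact_mod_cast h
    refine (sum_le_sum fun E _ => hg E).trans ?_
    rw [sum_const, card_univ, nsmul_eq_mul, card_endData]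
    refine mul_le_mul_of_nonneg_right ?_ (mul_nonneg (pow_nonneg (Nat.cast_nonneg _) _) hB0)
    have h : (Fintype.card (BIJ88PolymerRep5134Gauss.Site blk X'') + Fintype.card (BIJ88PolymerRep5134Gauss.Site blk X'') ^ 2) ^
        P.toList.length ≤ (nX + nX ^ 2) ^ N₀ :=
      (Nat.pow_le_pow_left (Nat.add_le_add hnX (Nat.pow_le_pow_left hnX 2)) _).trans
        (Nat.pow_le_pow_right (Nat.add_pos_left (by omega) _) hn)
    exact_mod_cast h
  refine (sum_le_sum fun σ hσ => sum_le_sum fun P hP => hstep σ hσ P hP).trans ?_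
  have hC0 : 0 ≤ ((nX : ℝ) + (nX : ℝ) ^ 2) ^ N₀ * ((GX : ℝ) ^ (2 * N₀) *
      (K₁ ^ N₀ * (Aχ ^ GX * AV ^ GX * θ ^ H.card * (ε * θ ^ (β' * (N₀ : ℝ)))))) :=
    mul_nonneg (by positivity) (mul_nonneg (by positivity) hB0)
  have h22 : ∀ σ ∈ smallParts X'', ((setPartitions σ).card : ℝ) ≤ (2 : ℝ) ^ 2 ^ N₀ := fun σ hσ => by
    exact_mod_cast (card_setPartitions_smallParts_le hσ).trans (Nat.pow_le_pow_right two_pos (Nat.pow_le_pow_right two_pos hN))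
  have h21 : ((smallParts X'').card : ℝ) ≤ (2 : ℝ) ^ 2 ^ N₀ := by
    exact_mod_cast (card_smallParts_le X'').trans (Nat.pow_le_pow_right two_pos (Nat.pow_le_pow_right two_pos hN))
  have hk : ((X'' \ H.image (cubeIn cube X ∘ γ')).card : ℝ) ≤ N₀ := by exact_mod_cast (card_le_card sdiff_subset).trans hN
  calc ∑ σ ∈ smallParts X'', ∑ P ∈ setPartitions σ, ((nX : ℝ) + (nX : ℝ) ^ 2) ^ N₀ * ((GX : ℝ) ^ (2 * N₀) *
          (K₁ ^ N₀ * (Aχ ^ GX * AV ^ GX * θ ^ H.card * (ε * θ ^ (β' * (N₀ : ℝ))))))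
      ≤ ∑ σ ∈ smallParts X'', (2 : ℝ) ^ 2 ^ N₀ * (((nX : ℝ) + (nX : ℝ) ^ 2) ^ N₀ * ((GX : ℝ) ^ (2 * N₀) *
          (K₁ ^ N₀ * (Aχ ^ GX * AV ^ GX * θ ^ H.card * (ε * θ ^ (β' * (N₀ : ℝ))))))) :=
        sum_le_sum fun σ hσ => by rw [sum_const, nsmul_eq_mul]; exact mul_le_mul_of_nonneg_right (h22 σ hσ) hC0
    _ ≤ (2 : ℝ) ^ 2 ^ N₀ * ((2 : ℝ) ^ 2 ^ N₀ * (((nX : ℝ) + (nX : ℝ) ^ 2) ^ N₀ * ((GX : ℝ) ^ (2 * N₀) *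
          (K₁ ^ N₀ * (Aχ ^ GX * AV ^ GX * θ ^ H.card * (ε * θ ^ (β' * (N₀ : ℝ)))))))) := by
        rw [sum_const, nsmul_eq_mul]; exact mul_le_mul_of_nonneg_right h21 (mul_nonneg (by positivity) hC0)
    _ = ((2 : ℝ) ^ 2 ^ N₀ * (2 : ℝ) ^ 2 ^ N₀ * ((nX : ℝ) + (nX : ℝ) ^ 2) ^ N₀ * (GX : ℝ) ^ (2 * N₀) * K₁ ^ N₀ * Aχ ^ GX *
          AV ^ GX * ε) * (θ ^ H.card * θ ^ (β' * (N₀ : ℝ))) := by ring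
    _ ≤ 1 * (θ ^ H.card * θ ^ (β' * (N₀ : ℝ))) :=
        mul_le_mul_of_nonneg_right hcnt (mul_nonneg (pow_nonneg hθ0.le _) (Real.rpow_nonneg hθ0.le _))
    _ ≤ θ ^ ((H.card : ℝ) + β' * ((X'' \ H.image (cubeIn cube X ∘ γ')).card : ℝ)) := by
        rw [one_mul, Real.rpow_add hθ0, Real.rpow_natCast]
        exact mul_le_mul_of_nonneg_left (Real.rpow_le_rpow_of_exponent_ge hθ0 hθ1 (mul_le_mul_of_nonneg_left hk hβ))
          (pow_nonneg hθ0.le _)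

/-- **THE LOCATED (5.14.4) IN THE BOUNDED-SIZE REGIME, IN THE SHAPE OF THE LEAF `h5144three`** of
`BIJ88Eq5145HeadThreeCubeChi.eq5145_zG_mod_W6v_of_ineq5144_three_le_struct_chi` restricted to `|X″| ≤ N₀`: for the located activity
`locAct (cubeIn cube X ∘ γ′) (actIn …) H X″` of `BIJ88Ineq5144Located` (the activity on located pairs, `0` otherwise),
`|locAct … H X″| ≤ θ^{|H| + β′·|X″ ∖ X_H|}`. [cite: BalabanImbrieJaffe1988, (5.14.3)–(5.14.4) p.309 L10–28; §5.13 p.307 L2–23] -/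
theorem abs_locAct_actIn_le_rpow_of_card_le (hΔ : Δ.PosDef) {m C₀ : ℝ} (hm : 0 < m)
    (hΔm : ∀ φ : α → ℝ, m * (φ ⬝ᵥ φ) ≤ φ ⬝ᵥ (Δ *ᵥ φ)) (hCΔ : ∀ v, v ⬝ᵥ (Δ *ᵥ v) ≤ C₀ * (v ⬝ᵥ v))
    (hek : 0 < ek) (ht : 0 < t) (h1 : t * ek < 1) (hΦ : ∀ b ∈ B, IsLinearMap ℝ (Φ b)) (hc : ∀ b ∈ B, c b ≠ 0)
    (hV : ∀ Y ∈ Ys, CbInf (V Y))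
    (X : Finset I) {S : Type*} [DecidableEq S] (γ' : S → ↥(slotB B Ys cube X) ⊕ ↥(slotY B Ys cube X)) (H : Finset S)
    {X'' : Finset I} (h2 : 2 ≤ X''.card) (hXs : ∃ x, blk x ∈ X'') (τ₀ : ↥(slotB B Ys cube X) ⊕ ↥(slotY B Ys cube X))
    {Λ : ℝ} (hΛ : 0 < Λ)
    (hframe : ∀ (θ : ↥(univ.filter fun b : ↥(slotB B Ys cube X) => cubeIn cube X (Sum.inl b) ∈ X'') → ℝ) (φ : α → ℝ),
      |∑ b, θ b * Φ b.1.1 φ| ≤ Λ * Real.sqrt (∑ b, θ b ^ 2) * Real.sqrt (φ ⬝ᵥ φ))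
    {F : ℝ} (hF0 : 0 ≤ F) (hF : src blk ℱ X'' ⬝ᵥ src blk ℱ X'' ≤ F ^ 2) {a a' : ↥(slotB B Ys cube X) → ℝ} (ha : ∀ b, 0 ≤ a b)
    {A : ↥(slotB B Ys cube X) ⊕ ↥(slotY B Ys cube X) → ℕ → ℕ → ℝ} (hA : ∀ τ m n, 0 ≤ A τ m n)
    (hA1 : ∀ b : ↥(slotB B Ys cube X), 1 ≤ A (Sum.inl b) 0 0)
    {w : ↥(slotB B Ys cube X) ⊕ ↥(slotY B Ys cube X) → BIJ88PolymerRep5134Gauss.Site blk X'' → ℝ} (hw : ∀ τ x, 0 ≤ w τ x)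
    (hχ : ∀ (κ : Type) [LinearOrder κ] (q : κ → BIJ88PolymerRep5134Gauss.Site blk X'') (b : ↥(slotB B Ys cube X)) (m : ℕ)
      (D' : Finset κ) (φ : BIJ88PolymerRep5134Gauss.Site blk X'' → ℝ), (m ≠ 0 ∨ D'.card ≠ 0) →
      |dset (fun j => Pi.single (q j) (1 : ℝ)) D'
        (fun ψ => uD χ p ek (slotB B Ys cube X) (fun b : ↥B => Φ b) (fun b : ↥B => c b) (slotY B Ys cube X) (fun Y : ↥Ys => V Y) t
          (Sum.inl b) m (ext blk X'' ψ)) φ| ≤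
        A (Sum.inl b) m D'.card * (∏ j ∈ D', w (Sum.inl b) (q j)) *
          Set.indicator (Set.Icc (a b) (a' b)) (fun _ => (1 : ℝ)) |Φ b.1 (ext blk X'' φ)|)
    (hY : ∀ (κ : Type) [LinearOrder κ] (q : κ → BIJ88PolymerRep5134Gauss.Site blk X'') (Y : ↥(slotY B Ys cube X)) (m : ℕ)
      (D' : Finset κ) (φ : BIJ88PolymerRep5134Gauss.Site blk X'' → ℝ),
      |dset (fun j => Pi.single (q j) (1 : ℝ)) D'
        (fun ψ => uD χ p ek (slotB B Ys cube X) (fun b : ↥B => Φ b) (fun b : ↥B => c b) (slotY B Ys cube X) (fun Y : ↥Ys => V Y) t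
          (Sum.inr Y) m (ext blk X'' ψ)) φ| ≤
        A (Sum.inr Y) m D'.card * ∏ j ∈ D', w (Sum.inr Y) (q j))
    {κc : Finset (Finset I) → BIJ88PolymerRep5134Gauss.Site blk X'' → BIJ88PolymerRep5134Gauss.Site blk X'' → ℝ}
    (hκ : ∀ s : I → ℝ, (∀ i, 0 ≤ s i ∧ s i ≤ 1) → ∀ (cg : Finset (Finset I)) (x y : BIJ88PolymerRep5134Gauss.Site blk X''),
      |((prec blk (interpForm blk Δ (corner ℝ Λc)) X'' s)⁻¹ *
          wker (prec blk (interpForm blk Δ (corner ℝ Λc)) X'' s)⁻¹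
            (fun b => bmat (fun x : BIJ88PolymerRep5134Gauss.Site blk X'' => blk x.1)
                ((interpForm blk Δ (corner ℝ Λc)).submatrix Subtype.val Subtype.val) s b
              + (bmat (fun x : BIJ88PolymerRep5134Gauss.Site blk X'' => blk x.1)
                ((interpForm blk Δ (corner ℝ Λc)).submatrix Subtype.val Subtype.val) s b)ᵀ) cg) x y| ≤ κc cg x y)
    {Fq : BIJ88PolymerRep5134Gauss.Site blk X'' → ℝ} (hFq : ∀ q : BIJ88PolymerRep5134Gauss.Site blk X'', |ℱ q.1| ≤ Fq q)
    {N₀ M nX GX : ℕ} (hN : X''.card ≤ N₀) (hHM : H.card ≤ M)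
    (hnX : Fintype.card (BIJ88PolymerRep5134Gauss.Site blk X'') ≤ nX)
    (hGX : (univ.filter fun τ : ↥(slotB B Ys cube X) ⊕ ↥(slotY B Ys cube X) => cubeIn cube X τ ∈ X'').card ≤ GX) (hGX1 : 1 ≤ GX)
    (ht1 : t ≤ 1) (hw1 : ∀ τ x, w τ x ≤ 1) {K₁ F₀ : ℝ} (hK1 : 1 ≤ K₁) (hκ1 : ∀ cg x y, κc cg x y ≤ K₁) (hFq1 : ∀ y, Fq y ≤ F₀)
    (hvol : (Fintype.card (BIJ88PolymerRep5134Gauss.Site blk X'') : ℝ) * F₀ ≤ 1)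
    {θ θS θV Aχ AV ε β' : ℝ} (hekθ : ek ≤ θ) (hθ1 : θ ≤ 1) (hθS0 : 0 ≤ θS) (hθS1 : θS ≤ 1) (hθV0 : 0 ≤ θV) (hθVθ : θV ≤ θ)
    (hAχ : 1 ≤ Aχ) (hAV : 1 ≤ AV) (hε : 0 ≤ ε) (hβ : 0 ≤ β')
    (hSε : θS ≤ ε * θ ^ (β' * (N₀ : ℝ))) (hVε : θV ≤ ε * θ ^ (β' * (N₀ : ℝ)))
    (hAχ' : ∀ b md nd, md ≤ M → nd ≤ 2 * N₀ → t ^ md * A (Sum.inl b) md nd ≤ Aχ) (hA10 : ∀ b, A (Sum.inl b) 0 0 ≤ 1)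
    (hAV' : ∀ Y md nd, md ≤ M → nd ≤ 2 * N₀ → A (Sum.inr Y) md nd ≤ AV * θV ^ (md + nd))
    (hS : ∀ b : ↥(slotB B Ys cube X), cubeIn cube X (Sum.inl b) ∈ X'' →
      2 * Real.exp (-(a b * (a b - 2 * (Λ * F / m)) / (2 * (Λ ^ 2 / m)))) ≤ (t * ek) ^ M * θS)
    (hcnt : (2 : ℝ) ^ 2 ^ N₀ * (2 : ℝ) ^ 2 ^ N₀ * ((nX : ℝ) + (nX : ℝ) ^ 2) ^ N₀ * (GX : ℝ) ^ (2 * N₀) * K₁ ^ N₀ * Aχ ^ GX *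
      AV ^ GX * ε ≤ 1) :
    |locAct (cubeIn cube X ∘ γ') (actIn blk Δ ℱ adj χ p ek B Φ c Ys V cube Λc X t γ') H X''| ≤
      θ ^ ((H.card : ℝ) + β' * ((X'' \ H.image (cubeIn cube X ∘ γ')).card : ℝ)) := by
  by_cases hloc : ∀ j ∈ H, (cubeIn cube X ∘ γ') j ∈ X''
  · rw [locAct_of_loc hloc]
    exact abs_actIn_le_rpow_of_card_le blk Δ ℱ χ p B Ys cube adj Λc hΔ hm hΔm hCΔ hek ht h1 hΦ hc hV X γ' H h2 hXs τ₀ hΛ hframe hF0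
      hF ha hA hA1 hw hχ hY hκ hFq hN hHM hnX hGX hGX1 ht1 hw1 hK1 hκ1 hFq1 hvol hekθ hθ1 hθS0 hθS1 hθV0 hθVθ hAχ hAV hε hβ hSε hVε
      hAχ' hA10 hAV' hS hcnt (fun j hj => hloc j hj)
  · rw [locAct_of_not_loc hloc, abs_zero]
    exact Real.rpow_nonneg (hek.le.trans hekθ) _

end Literature.MathematicalPhysics.QuantumFieldTheory.BalabanImbrieJaffe1984to88.BIJ88Ineq5144BoundedSize309
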